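import Literature.AnabelianGeometry.EtaleTheta.SettingModelGfpTwistTempered
import Literature.AnabelianGeometry.EtaleTheta.SettingModelChiTwistContinuity
import Literature.AnabelianGeometry.EtaleTheta.SettingModelCyclotomicCharacter
import Literature.AnabelianGeometry.EtaleTheta.SettingModelGalois
import Literature.AnabelianGeometry.EtaleTheta.SettingModelChiSemidirect
import Literature.AnabelianGeometry.SemiGraphs.TemperedDecompositionCompact
import HarnessLib

/-!
# Root models of [EtTh] §1, χ-twisted reshape (R78 (B)): `Γ ⋊_χ G_{ℚ_p}` IS TEMPERED — the cyclotomic instance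
# («F4c», proof-only; the `isTempered` field of `GroupLevelData (curveχ p)` up to the carrier name)

Mochizuki, *Semi-graphs of anabelioids*, Publ. RIMS **42** (2006) [SemiAnbd], Ex. 3.10 p. 43 («`π₁^temp(X_K)` is a
tempered topological group … `1 → π₁^temp(X_K̄) → π₁^temp(X_K) → G_K → 1`») [cite: MochizukiSemiAnbd2006, Ex 3.10 p.43];
[EtTh] §1 p. 12 [cite: MochizukiEtTh2009, §1 p.12].  abc-iut cell, seat abc-iut-w5-d111 (gen 3); R78 cluster brick «F4c».
PROOF-ONLY over this seat's `isTempered_gfp_twist_semidirect` (SettingModelGfpTwistTempered), abc-iut-w5-d024's JOINT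
continuity of the twist `continuous_twist_of_isLocallyConstant` (SettingModelChiTwistContinuity), abc-iut-w5-d091's
cyclotomic character `chi p : G_{ℚ_p} →* Aut(Ẑ)` with `isLocallyConstant_levelChar_chi` (SettingModelCyclotomicCharacter),
and abc-iut-L2-t1's `compactSpace_GQp` / `totallyDisconnectedSpace_GQp` (SettingModelGalois).

* `isTempered_gfp_twist_semidirect_of_isLocallyConstant` — the local-constancy form: for a profinite `G` and any
  `c : G →* Aut(Ẑ)` whose level characters `χ_N ∘ c` are locally constant, `Γ ⋊[twistGfp ∘ c] G` is tempered for any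
  group topology with `(left, right)` a topological embedding.
* **`isTempered_gfp_chi_semidirect`** — the instance `G := G_{ℚ_p}` (Krull), `c := chi p`: for EVERY `φ` with
  `φ σ q = twistGfp (chi p σ) q` (F4's `actχ p := twistGfp.comp (chi p)` definitionally) and every such topology on
  `Γ ⋊[φ] G_{ℚ_p}` (F4's `PiTpχ p`), `IsTempered (Γ ⋊[φ] G_{ℚ_p})`.  At F4's carrier:
  `isTempered_gfp_chi_semidirect p (fun _ _ => rfl) isInducing_leftRight : IsTempered (PiTpχ p)`.
* **`isTempered_PiTpχ`**, `isTempered_piTemp_curveχ`, `isTempered_deltaTemp_curveχ` — at abc-iut-w5-d249's F4 carrier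
  `PiTpχ p` (SettingModelChiSemidirect, p429710): `Π^tp_X` of the χ-twisted model and its `Δ^tp_X` ARE TEMPERED — the
  `isTempered` / `isTempered_ker`-type fields of `TemperedCurve.GroupLevelData (curveχ p)` ([SemiAnbd] Ex. 3.10, ruling η′).
Semi-synthetic model plumbing, consistency evidence only; nothing of [EtTh] asserted; no side taken on [IUTchIII] Cor. 3.12.
-/

noncomputable section

namespace Literature.AnabelianGeometry.EtaleTheta.SettingModel

open Literature.AnabelianGeometry.SemiGraphs
open _root_.Topology

/-- **`Γ ⋊_{θ∘c} G` is tempered, local-constancy form**: `G` profinite, `c : G →* Aut(Ẑ)` with locally constant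
level characters (then `(σ, x) ↦ θ_{c σ} x` is jointly continuous, abc-iut-w5-d024), `φ = twistGfp ∘ c`, any
group topology on `Γ ⋊[φ] G` with `(left, right)` a topological embedding. [cite: MochizukiSemiAnbd2006, Ex 3.10 p.43] -/
theorem isTempered_gfp_twist_semidirect_of_isLocallyConstant {G : Type*} [Group G] [TopologicalSpace G]
    [IsTopologicalGroup G] [CompactSpace G] [T2Space G] [TotallyDisconnectedSpace G]
    (c : G →* MulAut ZH) (hc : ∀ N : ℕ+, IsLocallyConstant fun σ => ZHatLevel.levelChar N (c σ))
    {φ : G →* MulAut Gfp} (hφ : ∀ (σ : G) (q : Gfp), φ σ q = twistGfp (c σ) q)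
    [TopologicalSpace (Gfp ⋊[φ] G)] [IsTopologicalGroup (Gfp ⋊[φ] G)]
    (hι : IsInducing fun g : Gfp ⋊[φ] G => (g.left, g.right)) : IsTempered (Gfp ⋊[φ] G) := by
  have hj : Continuous fun q : G × F₂hatT => twist (c q.1) q.2 :=
    continuous_twist_of_isLocallyConstant (fun σ => c σ) hc
  have hcont : ∀ x : F₂hatT, Continuous fun σ : G => twist (c σ) x := fun x =>
    hj.comp₂ continuous_id continuous_const
  exact isTempered_gfp_twist_semidirect c hcont hφ hι

/-- **`Γ ⋊_χ G_{ℚ_p}` is tempered** ([SemiAnbd] Ex. 3.10 at the χ-twisted root model): `G_{ℚ_p}` with its Krull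
topology (profinite: abc-iut-L2-t1's `compactSpace_GQp`, `totallyDisconnectedSpace_GQp`, Mathlib `krullTopology_t2`),
the cyclotomic character `chi p` (locally constant levels, abc-iut-w5-d091's `isLocallyConstant_levelChar_chi`), ANY
action `φ` that is `twistGfp ∘ chi p` pointwise (F4's `actχ p`, by `rfl`) and ANY group topology on the semidirect
product with `(left, right)` a topological embedding (F4's `PiTpχ p`). [cite: MochizukiSemiAnbd2006, Ex 3.10 p.43] -/
theorem isTempered_gfp_chi_semidirect (p : ℕ) [Fact p.Prime] {φ : GQp p →* MulAut Gfp}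
    (hφ : ∀ (σ : GQp p) (q : Gfp), φ σ q = twistGfp (chi p σ) q)
    [TopologicalSpace (Gfp ⋊[φ] GQp p)] [IsTopologicalGroup (Gfp ⋊[φ] GQp p)]
    (hι : IsInducing fun g : Gfp ⋊[φ] GQp p => (g.left, g.right)) : IsTempered (Gfp ⋊[φ] GQp p) := by
  haveI : IsGalois ℚ_[p] (AlgebraicClosure ℚ_[p]) := {}
  haveI : CompactSpace (GQp p) := compactSpace_GQp p
  haveI : T2Space (GQp p) := krullTopology_t2
  haveI : TotallyDisconnectedSpace (GQp p) := totallyDisconnectedSpace_GQp p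
  exact isTempered_gfp_twist_semidirect_of_isLocallyConstant (chi p) (isLocallyConstant_levelChar_chi p) hφ hι

/-! ### At F4's carrier `PiTpχ p` -/

/-- **`Π^tp_X := Γ ⋊_χ G_{ℚ_p}` of the χ-twisted model (abc-iut-w5-d249's `PiTpχ p`) IS TEMPERED** ([SemiAnbd]
Ex. 3.10 «`π₁^temp(X_K)` … tempered» at the model; `actχ p = twistGfp ∘ chi p` by `rfl`, topology induced along
`(left, right)`). [cite: MochizukiSemiAnbd2006, Ex 3.10 p.43] -/
theorem isTempered_PiTpχ (p : ℕ) [Fact p.Prime] : IsTempered (PiTpχ p) :=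
  isTempered_gfp_chi_semidirect p (fun _ _ => rfl) (isInducing_leftRightχ p)

/-- The same, read on the `TemperedCurve` record `curveχ p` (its `PiTemp` is `PiTpχ p`): the `isTempered` field of
`TemperedCurve.GroupLevelData (curveχ p)`. [cite: MochizukiSemiAnbd2006, Ex 3.10 p.43] -/
theorem isTempered_piTemp_curveχ (p : ℕ) [Fact p.Prime] : IsTempered (curveχ p).PiTemp :=
  isTempered_PiTpχ p

/-- **`Δ^tp_X` of the χ-twisted model is tempered** («Note that `Δ` is also tempered», Ex. 3.10 p. 43): a closed
subgroup of the tempered `Π^tp_X` (this seat's `TemperedCurve.isTempered_deltaTemp_of_isTempered`, p417615).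
[cite: MochizukiSemiAnbd2006, Ex 3.10 p.43] -/
theorem isTempered_deltaTemp_curveχ (p : ℕ) [Fact p.Prime] : IsTempered (curveχ p).DeltaTemp :=
  TemperedCurve.isTempered_deltaTemp_of_isTempered (curveχ p) (isTempered_piTemp_curveχ p)

end Literature.AnabelianGeometry.EtaleTheta.SettingModel

end
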